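import Summits.Ventures.CertifiedManyBodySolver.Observables.PhaseSeparationExclusionBoxGrandCanonicalThermalFreeDilute
import HarnessLib

/-!
# Ventures/CertifiedManyBodySolver — Observables/PhaseSeparationExclusionBoxGrandCanonicalTcap.lean: the μ-AXIS competing-order cell forms with a
# `t′`-AFFINE CAP `c₀ + c_s·s + c₁·U` (the registry witness planes at filling `1/2` / `3/4`): `T = 0` gap, `T > 0` one-`μ` exclusion and `T > 0` gap,
# column × threshold forms with `s`-dependent anchors

HONEST FRAMING: a transport device; the `c_s ≠ 0` editions of `psGC_gap_on_cell_of_columns` (g22), `psGCT_not_equilibrium_on_cell_of_columns_hotAnchorSS` and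
`psGCT_gap_on_cell_of_columns_hotAnchorSS` (g25), obtained from the function forms `psGC_gap_on_cell_of_fns` / `psGCT_not_equilibrium_on_cell_of_fns_hotAnchorFn` /
`psGCT_gap_on_cell_of_fns_hotAnchorFn` with `C s U := c₀ + c_s s + c₁ U` and the `U`-chord of the two column laws as the dense floor (everything affine in `U` at
fixed `s` ⇒ two column checks per `s`; affine in `s` ⇒ two `s`-checks per column in the instances). Needed by the MID-SEGMENT-CAP words (this seat g26): their cap is the
registry's filling-`1/2` open-box witness plane `r468`, which is `t′`-affine (`fp_cap_r468_tcap_on_cell`). Laws: `margin_le_mul_sub_chemPot_of_groundStates_ttPrime`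
(`T = 0`), `IsVarEquilibrium.not_isVarEquilibrium_of_le_of_le_hotAnchors_ttPrime` and `mul_gap_le_mul_sub_chemPot_of_equilibria_hotAnchors_threshold_ttPrime`
(`T > 0`) — this seat g22–g24, [Israel1979] Thm I.2.4 read on the `μ` axis by one Legendre/Jensen step. CONTROL class; conditional on whatever nodes an instance
names; statements about translation-invariant mean-energy minimisers / variational equilibria of `H − μN` (existence not claimed); a FLOOR on `Δμ`, not an estimate;
nothing about stripes, SC or `T_c`; no number of record. Zero kit, no definition, no claim node.

Cell `pub/hubbard-downfold` (MO-S1 filling lane; D-0096 (iii), μ axis of the D-0098 map), seat `hubbard-downfold-unc-2` (g26), 2026-08-29.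
References: R. B. Israel (1979) Thm I.2.4 / I.3.4 [Israel1979]; D. Ruelle (1969) §3.3–3.4 [Ruelle1969]; R. B. Griffiths, J. Math. Phys. 5 (1964) 1215
[Griffiths1966]; D. Poulin, M. B. Hastings, PRL 106 (2011) 080403 [PoulinHastings2011].
-/

noncomputable section

namespace Summit.Ventures.CertifiedManyBodySolver.Observables

open Literature.MathematicalPhysics.QuantumLattice Literature.MathematicalPhysics.QuantumLattice.ThermodynamicLimit
open Literature.MathematicalPhysics.QuantumLattice.InfVolFermionState Set Filter

/-! ## §1 `T = 0`: the certified chemical-potential gap on a cell, `t′`-affine cap -/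

/-- **CELL-UNIFORM `T = 0` GAP, COLUMN FORM, CAP AFFINE IN `(s, U)`.** Cell `[s₁, s₂] × [U₁, U₂]` (`0 ≤ U₁ < U₂`), `0 < n₁ < n₂ < 2`, weights
`a + b = 1`; cap `e(t,s,U,a n₁ + b n₂) ≤ c₀ + c_s s + c₁ U`; column laws `L_i(s) ≤ e(t,s,U_i,n₂)`; dilute floor `F₁(s)`; both column margins `≥ g` for every
`s`. Then for every `(s, U)` of the cell, every `μ₁` carrying a translation-invariant ground state of `H(t,s,U) − μ₁N` of density `≤ n₁` and every `μ₂` carrying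
one of density `≥ n₂`: `a·b·(n₂ − n₁)·(μ₂ − μ₁) ≥ g`. [cite: Israel1979, Thm. I.2.4] [cite: Ruelle1969, §3.3] -/
theorem psGC_gap_on_cell_of_columns_tcap (t : ℝ) {s₁ s₂ U₁ U₂ n₁ n₂ a b c₀ cs c₁ g : ℝ} (hU₁ : 0 ≤ U₁) (h12 : U₁ < U₂)
    (hn₁ : 0 < n₁) (hn : n₁ < n₂) (hn₂ : n₂ < 2) (ha : 0 ≤ a) (hb : 0 ≤ b) (hab : a + b = 1) {L₁ L₂ F₁ : ℝ → ℝ}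
    (hC : ∀ s ∈ Icc s₁ s₂, ∀ U ∈ Icc U₁ U₂, energyDensityTT' t s U (a * n₁ + b * n₂) ≤ c₀ + cs * s + c₁ * U)
    (hL₁ : ∀ s ∈ Icc s₁ s₂, L₁ s ≤ energyDensityTT' t s U₁ n₂) (hL₂ : ∀ s ∈ Icc s₁ s₂, L₂ s ≤ energyDensityTT' t s U₂ n₂)
    (hF₁ : ∀ s ∈ Icc s₁ s₂, ∀ U ∈ Icc U₁ U₂, F₁ s ≤ energyDensityTT' t s U n₁)
    (hgm₁ : ∀ s ∈ Icc s₁ s₂, g ≤ a * F₁ s + b * L₁ s - (c₀ + cs * s + c₁ * U₁))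
    (hgm₂ : ∀ s ∈ Icc s₁ s₂, g ≤ a * F₁ s + b * L₂ s - (c₀ + cs * s + c₁ * U₂))
    {s : ℝ} (hs : s ∈ Icc s₁ s₂) {U : ℝ} (hU : U ∈ Icc U₁ U₂)
    {Γ₁ Γ₂ : FermionInteraction 2} {R₁ R₂ μ₁ μ₂ : ℝ} {ω₁ ω₂ : InfVolFermionState 2}
    (hω₁ : ω₁.IsMeanEnergyMinimiser Γ₁ R₁)
    (hΓ₁ : ∀ σ : InfVolFermionState 2, σ.meanEnergy Γ₁ R₁ = σ.meanEnergy (hubbardTTPrimeFermionInteraction t s U) 1 - μ₁ * σ.density)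
    (hω₂ : ω₂.IsMeanEnergyMinimiser Γ₂ R₂)
    (hΓ₂ : ∀ σ : InfVolFermionState 2, σ.meanEnergy Γ₂ R₂ = σ.meanEnergy (hubbardTTPrimeFermionInteraction t s U) 1 - μ₂ * σ.density)
    (hρ₁ : ω₁.density ≤ n₁) (hρ₂ : n₂ ≤ ω₂.density) :
    g ≤ a * b * (n₂ - n₁) * (μ₂ - μ₁) := by
  have hn2' : 0 ≤ n₂ := hn₁.le.trans hn.le
  refine psGC_gap_on_cell_of_fns t hU₁ hn₁ hn hn₂ ha hb hab (C := fun s U => c₀ + cs * s + c₁ * U) (F₁ := fun s _ => F₁ s)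
    (F₂ := fun s U => ((U₂ - U) * L₁ s + (U - U₁) * L₂ s) / (U₂ - U₁)) hC hF₁
    (floor_on_cell_of_columnLaws t hn2' hn₂ hU₁ h12 hL₁ hL₂) ?_ hs hU hω₁ hΓ₁ hω₂ hΓ₂ hρ₁ hρ₂
  intro s hs U hU
  have hd : (U₂ - U₁) ≠ 0 := (sub_pos.2 h12).ne'
  have hge := chord_ge_of_ends_ge h12 hU (hgm₁ s hs) (hgm₂ s hs)
  have hidM : a * F₁ s + b * (((U₂ - U) * L₁ s + (U - U₁) * L₂ s) / (U₂ - U₁)) - (c₀ + cs * s + c₁ * U) =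
      ((U₂ - U) * (a * F₁ s + b * L₁ s - (c₀ + cs * s + c₁ * U₁)) + (U - U₁) * (a * F₁ s + b * L₂ s - (c₀ + cs * s + c₁ * U₂))) /
        (U₂ - U₁) := by
    field_simp
    ring
  show g ≤ a * F₁ s + b * (((U₂ - U) * L₁ s + (U - U₁) * L₂ s) / (U₂ - U₁)) - (c₀ + cs * s + c₁ * U)
  rw [hidM]
  exact hge

/-! ## §2 `T > 0`: no `(β, μ)` carries both phases, `t′`-affine cap, `s`-dependent anchors -/

/-- **NO `(β, μ)` CARRIES BOTH PHASES, COLUMN × THRESHOLD FORM, CAP AFFINE IN `(s, U)`, `s`-DEPENDENT ANCHORS `Q₁(s)`, `Q₂(s)`** (hypotheses exactly as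
`psT_not_thermal_mix_on_cell_of_columns_hotAnchorSS_tcap`, with `0 < n₁`): on `[s₁, s₂] × [U₁, U₂]`, for every `β ≥ β₀` and every `μ`, no variational equilibrium
of `H(t,s,U) − μN` of density `≥ n₂` coexists with one of density `≤ n₁`. [cite: Israel1979, Thm. I.2.4] [cite: PoulinHastings2011, eqs. (3)–(8)] [cite: Ruelle1969, §3.4] -/
theorem psGCT_not_equilibrium_on_cell_of_columns_hotAnchorSS_tcap (t : ℝ) {s₁ s₂ U₁ U₂ n₁ n₂ a b c₀ cs c₁ β β₀ βh₁ βh₂ : ℝ}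
    (hU₁ : 0 ≤ U₁) (h12 : U₁ < U₂) (hn₁ : 0 < n₁) (hn : n₁ < n₂) (hn₂ : n₂ < 2) (ha : 0 ≤ a) (hb : 0 ≤ b)
    (hab : a + b = 1) (hβh₁ : 0 ≤ βh₁) (hβh₂ : 0 ≤ βh₂) (h0₁ : βh₁ ≤ β₀) (h0₂ : βh₂ ≤ β₀) (hβ₀ : β₀ ≤ β)
    (hβ₀pos : 0 < β₀) {L₁ L₂ F₁ Q₁ Q₂ : ℝ → ℝ}
    (hC : ∀ s ∈ Icc s₁ s₂, ∀ U ∈ Icc U₁ U₂, energyDensityTT' t s U (a * n₁ + b * n₂) ≤ c₀ + cs * s + c₁ * U)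
    (hL₁ : ∀ s ∈ Icc s₁ s₂, L₁ s ≤ energyDensityTT' t s U₁ n₂) (hL₂ : ∀ s ∈ Icc s₁ s₂, L₂ s ≤ energyDensityTT' t s U₂ n₂)
    (hF₁ : ∀ s ∈ Icc s₁ s₂, ∀ U ∈ Icc U₁ U₂, F₁ s ≤ energyDensityTT' t s U n₁)
    (hπ₁ : ∀ s ∈ Icc s₁ s₂, ∀ U ∈ Icc U₁ U₂, pressureTT' βh₁ t s U n₁ ≤ Q₁ s)
    (hπ₂ : ∀ s ∈ Icc s₁ s₂, ∀ U ∈ Icc U₁ U₂, pressureTT' βh₂ t s U n₂ ≤ Q₂ s)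
    (hm₁ : ∀ s ∈ Icc s₁ s₂, 0 ≤ a * F₁ s + b * L₁ s - (c₀ + cs * s + c₁ * U₁))
    (hm₂ : ∀ s ∈ Icc s₁ s₂, 0 ≤ a * F₁ s + b * L₂ s - (c₀ + cs * s + c₁ * U₂))
    (hg₁ : ∀ s ∈ Icc s₁ s₂,
      a * Q₁ s + b * Q₂ s + βh₁ * (a * F₁ s) + βh₂ * (b * L₁ s) < β₀ * (a * F₁ s + b * L₁ s - (c₀ + cs * s + c₁ * U₁)))
    (hg₂ : ∀ s ∈ Icc s₁ s₂,
      a * Q₁ s + b * Q₂ s + βh₁ * (a * F₁ s) + βh₂ * (b * L₂ s) < β₀ * (a * F₁ s + b * L₂ s - (c₀ + cs * s + c₁ * U₂)))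
    {s : ℝ} (hs : s ∈ Icc s₁ s₂) {U : ℝ} (hU : U ∈ Icc U₁ U₂)
    {Γ : FermionInteraction 2} {R' μ : ℝ} {ω₁ ω₂ : InfVolFermionState 2} (hω₁ : ω₁.IsVarEquilibrium β Γ R')
    (hΓ : ∀ σ : InfVolFermionState 2, σ.meanEnergy Γ R' = σ.meanEnergy (hubbardTTPrimeFermionInteraction t s U) 1 - μ * σ.density)
    (hρ₁ : ω₁.density ≤ n₁) (hρ₂ : n₂ ≤ ω₂.density) :
    ¬ ω₂.IsVarEquilibrium β Γ R' := by
  have hn2' : 0 ≤ n₂ := hn₁.le.trans hn.le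
  have hβpos : 0 < β := hβ₀pos.trans_le hβ₀
  refine psGCT_not_equilibrium_on_cell_of_fns_hotAnchorFn t hU₁ hβpos hn₁ hn hn₂ ha hb hab hβh₁ hβh₂ (h0₁.trans hβ₀)
    (h0₂.trans hβ₀) (C := fun s U => c₀ + cs * s + c₁ * U) (F₁ := fun s _ => F₁ s)
    (F₂ := fun s U => ((U₂ - U) * L₁ s + (U - U₁) * L₂ s) / (U₂ - U₁)) (P₁ := fun s _ => Q₁ s) (P₂ := fun s _ => Q₂ s) hC hF₁
    (floor_on_cell_of_columnLaws t hn2' hn₂ hU₁ h12 hL₁ hL₂) hπ₁ hπ₂ ?_ hs hU hω₁ hΓ hρ₁ hρ₂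
  intro s hs U hU
  have hd : (U₂ - U₁) ≠ 0 := (sub_pos.2 h12).ne'
  have e₁ : a * Q₁ s + b * Q₂ s <
      β₀ * (a * F₁ s + b * L₁ s - (c₀ + cs * s + c₁ * U₁)) - (βh₁ * (a * F₁ s) + βh₂ * (b * L₁ s)) := by
    have := hg₁ s hs; linarith
  have e₂ : a * Q₁ s + b * Q₂ s <
      β₀ * (a * F₁ s + b * L₂ s - (c₀ + cs * s + c₁ * U₂)) - (βh₁ * (a * F₁ s) + βh₂ * (b * L₂ s)) := by
    have := hg₂ s hs; linarith
  have hchord := chord_gt_of_ends_gt h12 hU e₁ e₂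
  have hid : β₀ * (a * F₁ s + b * (((U₂ - U) * L₁ s + (U - U₁) * L₂ s) / (U₂ - U₁)) - (c₀ + cs * s + c₁ * U)) -
        (βh₁ * (a * F₁ s) + βh₂ * (b * (((U₂ - U) * L₁ s + (U - U₁) * L₂ s) / (U₂ - U₁)))) =
      ((U₂ - U) * (β₀ * (a * F₁ s + b * L₁ s - (c₀ + cs * s + c₁ * U₁)) - (βh₁ * (a * F₁ s) + βh₂ * (b * L₁ s))) +
        (U - U₁) * (β₀ * (a * F₁ s + b * L₂ s - (c₀ + cs * s + c₁ * U₂)) - (βh₁ * (a * F₁ s) + βh₂ * (b * L₂ s)))) /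
        (U₂ - U₁) := by
    field_simp
    ring
  rw [← hid] at hchord
  have hge := chord_ge_of_ends_ge h12 hU (hm₁ s hs) (hm₂ s hs)
  have hidM : a * F₁ s + b * (((U₂ - U) * L₁ s + (U - U₁) * L₂ s) / (U₂ - U₁)) - (c₀ + cs * s + c₁ * U) =
      ((U₂ - U) * (a * F₁ s + b * L₁ s - (c₀ + cs * s + c₁ * U₁)) + (U - U₁) * (a * F₁ s + b * L₂ s - (c₀ + cs * s + c₁ * U₂))) /
        (U₂ - U₁) := by
    field_simp
    ring
  have hM : 0 ≤ a * F₁ s + b * (((U₂ - U) * L₁ s + (U - U₁) * L₂ s) / (U₂ - U₁)) - (c₀ + cs * s + c₁ * U) := hidM ▸ hge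
  have k := mul_le_mul_of_nonneg_right hβ₀ hM
  show a * Q₁ s + b * Q₂ s + βh₁ * (a * F₁ s) + βh₂ * (b * (((U₂ - U) * L₁ s + (U - U₁) * L₂ s) / (U₂ - U₁))) <
    β * (a * F₁ s + b * (((U₂ - U) * L₁ s + (U - U₁) * L₂ s) / (U₂ - U₁)) - (c₀ + cs * s + c₁ * U))
  linarith

/-! ## §3 `T > 0`: the certified chemical-potential gap on a cell, `t′`-affine cap, `s`-dependent anchors -/

/-- **CELL-UNIFORM `T > 0` GAP, COLUMN × THRESHOLD FORM, CAP AFFINE IN `(s, U)`, `s`-DEPENDENT ANCHORS**: cap `c₀ + c_s s + c₁ U`, two `n₂`-column laws,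
dilute floor, both column margins `≥ g` and `a Q₁(s) + b Q₂(s) + β_{h,1} a F₁(s) + β_{h,2} b L_i(s) ≤ β₀·(a F₁(s) + b L_i(s) − (c₀ + c_s s + c₁U_i) − g)` on both
columns; then on `[s₁, s₂] × [U₁, U₂]`, for every `β ≥ β₀`: `a·b·(n₂ − n₁)·(μ₂ − μ₁) ≥ g` between any `μ₁` carrying a variational equilibrium of density `≤ n₁` and
any `μ₂` carrying one of density `≥ n₂`. [cite: Israel1979, Thm. I.2.4] [cite: Ruelle1969, §3.4] [cite: PoulinHastings2011, eqs. (3)–(8)] -/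
theorem psGCT_gap_on_cell_of_columns_hotAnchorSS_tcap (t : ℝ) {s₁ s₂ U₁ U₂ n₁ n₂ a b c₀ cs c₁ β₀ βh₁ βh₂ g : ℝ}
    (hU₁ : 0 ≤ U₁) (h12 : U₁ < U₂) (hn₁ : 0 < n₁) (hn : n₁ < n₂) (hn₂ : n₂ < 2) (ha : 0 ≤ a) (hb : 0 ≤ b)
    (hab : a + b = 1) (hβh₁ : 0 ≤ βh₁) (hβh₂ : 0 ≤ βh₂) (h0₁ : βh₁ ≤ β₀) (h0₂ : βh₂ ≤ β₀) (hβ₀pos : 0 < β₀) {L₁ L₂ F₁ Q₁ Q₂ : ℝ → ℝ}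
    (hC : ∀ s ∈ Icc s₁ s₂, ∀ U ∈ Icc U₁ U₂, energyDensityTT' t s U (a * n₁ + b * n₂) ≤ c₀ + cs * s + c₁ * U)
    (hL₁ : ∀ s ∈ Icc s₁ s₂, L₁ s ≤ energyDensityTT' t s U₁ n₂) (hL₂ : ∀ s ∈ Icc s₁ s₂, L₂ s ≤ energyDensityTT' t s U₂ n₂)
    (hF₁ : ∀ s ∈ Icc s₁ s₂, ∀ U ∈ Icc U₁ U₂, F₁ s ≤ energyDensityTT' t s U n₁)
    (hπ₁ : ∀ s ∈ Icc s₁ s₂, ∀ U ∈ Icc U₁ U₂, pressureTT' βh₁ t s U n₁ ≤ Q₁ s)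
    (hπ₂ : ∀ s ∈ Icc s₁ s₂, ∀ U ∈ Icc U₁ U₂, pressureTT' βh₂ t s U n₂ ≤ Q₂ s)
    (hgm₁ : ∀ s ∈ Icc s₁ s₂, g ≤ a * F₁ s + b * L₁ s - (c₀ + cs * s + c₁ * U₁))
    (hgm₂ : ∀ s ∈ Icc s₁ s₂, g ≤ a * F₁ s + b * L₂ s - (c₀ + cs * s + c₁ * U₂))
    (hN₁ : ∀ s ∈ Icc s₁ s₂,
      a * Q₁ s + b * Q₂ s + βh₁ * (a * F₁ s) + βh₂ * (b * L₁ s) ≤ β₀ * (a * F₁ s + b * L₁ s - (c₀ + cs * s + c₁ * U₁) - g))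
    (hN₂ : ∀ s ∈ Icc s₁ s₂,
      a * Q₁ s + b * Q₂ s + βh₁ * (a * F₁ s) + βh₂ * (b * L₂ s) ≤ β₀ * (a * F₁ s + b * L₂ s - (c₀ + cs * s + c₁ * U₂) - g))
    {s : ℝ} (hs : s ∈ Icc s₁ s₂) {U : ℝ} (hU : U ∈ Icc U₁ U₂) {β : ℝ} (hβ : β₀ ≤ β)
    {Γ₁ Γ₂ : FermionInteraction 2} {R₁ R₂ μ₁ μ₂ : ℝ} {ω₁ ω₂ : InfVolFermionState 2}
    (hω₁ : ω₁.IsVarEquilibrium β Γ₁ R₁)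
    (hΓ₁ : ∀ σ : InfVolFermionState 2, σ.meanEnergy Γ₁ R₁ = σ.meanEnergy (hubbardTTPrimeFermionInteraction t s U) 1 - μ₁ * σ.density)
    (hω₂ : ω₂.IsVarEquilibrium β Γ₂ R₂)
    (hΓ₂ : ∀ σ : InfVolFermionState 2, σ.meanEnergy Γ₂ R₂ = σ.meanEnergy (hubbardTTPrimeFermionInteraction t s U) 1 - μ₂ * σ.density)
    (hρ₁ : ω₁.density ≤ n₁) (hρ₂ : n₂ ≤ ω₂.density) :
    g ≤ a * b * (n₂ - n₁) * (μ₂ - μ₁) := by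
  have hn2' : 0 ≤ n₂ := hn₁.le.trans hn.le
  refine psGCT_gap_on_cell_of_fns_hotAnchorFn t hU₁ hβ₀pos hn₁ hn hn₂ ha hb hab hβh₁ hβh₂ h0₁ h0₂
    (C := fun s U => c₀ + cs * s + c₁ * U) (F₁ := fun s _ => F₁ s)
    (F₂ := fun s U => ((U₂ - U) * L₁ s + (U - U₁) * L₂ s) / (U₂ - U₁)) (P₁ := fun s _ => Q₁ s) (P₂ := fun s _ => Q₂ s) hC hF₁
    (floor_on_cell_of_columnLaws t hn2' hn₂ hU₁ h12 hL₁ hL₂) hπ₁ hπ₂ ?_ ?_ hs hU hβ hω₁ hΓ₁ hω₂ hΓ₂ hρ₁ hρ₂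
  · intro s hs U hU
    have hd : (U₂ - U₁) ≠ 0 := (sub_pos.2 h12).ne'
    have hge := chord_ge_of_ends_ge h12 hU (hgm₁ s hs) (hgm₂ s hs)
    have hidM : a * F₁ s + b * (((U₂ - U) * L₁ s + (U - U₁) * L₂ s) / (U₂ - U₁)) - (c₀ + cs * s + c₁ * U) =
        ((U₂ - U) * (a * F₁ s + b * L₁ s - (c₀ + cs * s + c₁ * U₁)) + (U - U₁) * (a * F₁ s + b * L₂ s - (c₀ + cs * s + c₁ * U₂))) /
          (U₂ - U₁) := by
      field_simp
      ring
    show g ≤ a * F₁ s + b * (((U₂ - U) * L₁ s + (U - U₁) * L₂ s) / (U₂ - U₁)) - (c₀ + cs * s + c₁ * U)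
    rw [hidM]
    exact hge
  · intro s hs U hU
    have hd : (U₂ - U₁) ≠ 0 := (sub_pos.2 h12).ne'
    have e₁ : 0 ≤ β₀ * (a * F₁ s + b * L₁ s - (c₀ + cs * s + c₁ * U₁) - g) -
        (a * Q₁ s + b * Q₂ s + βh₁ * (a * F₁ s) + βh₂ * (b * L₁ s)) := by
      have := hN₁ s hs; linarith
    have e₂ : 0 ≤ β₀ * (a * F₁ s + b * L₂ s - (c₀ + cs * s + c₁ * U₂) - g) -
        (a * Q₁ s + b * Q₂ s + βh₁ * (a * F₁ s) + βh₂ * (b * L₂ s)) := by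
      have := hN₂ s hs; linarith
    have hchord := chord_ge_of_ends_ge h12 hU e₁ e₂
    have hid : β₀ * (a * F₁ s + b * (((U₂ - U) * L₁ s + (U - U₁) * L₂ s) / (U₂ - U₁)) - (c₀ + cs * s + c₁ * U) - g) -
          (a * Q₁ s + b * Q₂ s + βh₁ * (a * F₁ s) + βh₂ * (b * (((U₂ - U) * L₁ s + (U - U₁) * L₂ s) / (U₂ - U₁)))) =
        ((U₂ - U) * (β₀ * (a * F₁ s + b * L₁ s - (c₀ + cs * s + c₁ * U₁) - g) -
            (a * Q₁ s + b * Q₂ s + βh₁ * (a * F₁ s) + βh₂ * (b * L₁ s))) +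
          (U - U₁) * (β₀ * (a * F₁ s + b * L₂ s - (c₀ + cs * s + c₁ * U₂) - g) -
            (a * Q₁ s + b * Q₂ s + βh₁ * (a * F₁ s) + βh₂ * (b * L₂ s)))) /
          (U₂ - U₁) := by
      field_simp
      ring
    rw [← hid] at hchord
    show a * Q₁ s + b * Q₂ s + βh₁ * (a * F₁ s) + βh₂ * (b * (((U₂ - U) * L₁ s + (U - U₁) * L₂ s) / (U₂ - U₁))) ≤
      β₀ * (a * F₁ s + b * (((U₂ - U) * L₁ s + (U - U₁) * L₂ s) / (U₂ - U₁)) - (c₀ + cs * s + c₁ * U) - g)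
    linarith

end Summit.Ventures.CertifiedManyBodySolver.Observables

end
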